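import Mathlib.RingTheory.Localization.FractionRing
import Mathlib.RingTheory.Ideal.Quotient.Operations
import Mathlib.Algebra.MvPolynomial.Equiv
import Mathlib.Algebra.MvPolynomial.Supported
import Mathlib.RingTheory.Polynomial.Basic
import Literature.NumberTheory.Transcendental.NesterenkoElimination
import HarnessLib

/-!
# The elimination ideal `Ī(r)` of a prime ideal (Nesterenko, LNM 1752 Ch. 3 Def. 4.3) over a field: it is the kernel of an explicit homomorphism, hence prime

`Literature/NumberTheory/Transcendental/NesterenkoElimIdealPrime.lean`. First file of the proof of
LNM 1752 Ch. 3 **Proposition 4.4** (Yu. V. Nesterenko: for a homogeneous unmixed ideal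
`I ⊂ K[x₀, …, x_m]` of dimension `r − 1` the ideal `Ī(r) ⊂ K[u₁, …, u_r]` of Definition 4.3 is
principal, the generator attached to a prime being irreducible), vendored for `K = ℚ` as the
named fact `Nesterenko.NesterenkoPhilippon2001_ch3_prop_4_4` (`NesterenkoEliminationFacts.lean`).
The proof needs the definitions over an ARBITRARY field `K` (Ch. 10 of the book runs the same
theory over `K = ℂ(z)`, p. 153: "The field `K` is in our case the field of rational functions
`ℂ(z)`"), so this file

* re-issues Definition 4.3 over any field `K` — `NesterenkoK.linForm`, `NesterenkoK.extIdeal`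
  (`(I, L₁, …, L_r) ⊂ K[U, x̲]`), `NesterenkoK.elimIdeal` (`Ī(r)`), written so that the
  `K = ℚ` instances are DEFINITIONALLY the objects of `NesterenkoElimination.lean`
  (`Nesterenko.linForm_eq`, `Nesterenko.extIdeal_eq`, `Nesterenko.elimIdeal_eq`, all `rfl`);
* and proves the structure theorem behind Proposition 4.4 for a PRIME ideal `𝔭`: for every
  variable `xⱼ ∉ 𝔭`, the `K`-algebra homomorphism
  `Φⱼ : K[U, x̲] → K(𝔭)[U]` (`NesterenkoK.pivotMap`; `K(𝔭) = Frac(K[x̲]/𝔭)`, `xₖ ↦ x̄ₖ`,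
  `u_{ik} ↦ u_{ik}` for `k ≠ j`, `u_{ij} ↦ −(∑_{k≠j} u_{ik} x̄ₖ)/x̄ⱼ`, so that `Lᵢ ↦ 0`) satisfies
  **`G ∈ Ī(r) ⟺ Φⱼ(G) = 0`** (`NesterenkoK.mem_elimIdeal_iff_pivotMap_eq_zero`), whence
  `Ī(r)` is a PRIME ideal of `K[U]` (`NesterenkoK.isPrime_elimIdeal`,
  `Nesterenko.isPrime_elimIdeal_of_X_notMem`).

The key step is the saturation `NesterenkoK.exists_pow_mul_sub_mem_span_linForm`: modulo
`(L₁, …, L_r)` every `G` satisfies `xⱼ^N G ≡ H` with `H` free of `u_{1j}, …, u_{rj}` (substitute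
`xⱼ u_{ij} = Lᵢ − ∑_{k≠j} u_{ik} xₖ`), and on such `H` the map `Φⱼ` is reduction of the
coefficients modulo `𝔭` (`NesterenkoK.mem_map_of_pivotMap_eq_zero`), so `ker Φⱼ` is the
`xⱼ`-saturation of `(𝔭, L₁, …, L_r)` (`NesterenkoK.exists_pow_mul_mem_extIdeal`,
`NesterenkoK.pivotMap_eq_zero_of_pow_mul_mem`) and does not depend on the pivot
(`NesterenkoK.pivotMap_eq_zero_iff_pivotMap_eq_zero`). The sequel
(`NesterenkoChowFormPrime.lean`) computes the transcendence degree of `K[U]/Ī(r)` with the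
generic-linear-forms theorem of `Literature/RingTheory/NoetherNormalization/GenericLinearForms.lean`
and deduces that `Ī(r)` is a non-zero principal prime for `dim 𝔭 = r − 1`.

## References

* [NesterenkoPhilippon2001] Yu. V. Nesterenko, P. Philippon (eds.), *Introduction to Algebraic
  Independence Theory*, LNM 1752, Springer 2001, Ch. 3 §4 Def. 4.3, Prop. 4.4 (p. 38);
  Ch. 10 §2 (p. 153).
* [Nes10] Yu. V. Nesterenko, Proc. Steklov Inst. Math. 218 (1997) 294–331, §1 (Prop. 1.1).
* Zhu Yaochen, *Transcendental numbers: algebraic independence* (USTC Press), App. 2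
  (`L`-elimination ideals), Prop. 1, Lemma 5.
-/

noncomputable section

open MvPolynomial

namespace Literature.NumberTheory.Transcendental

namespace NesterenkoK

variable (K : Type*) [Field K]

/-! ### Definition 4.3 over an arbitrary field `K` -/

/-- The generic linear forms `Lᵢ = ∑ⱼ u_{ij} xⱼ ∈ K[U, x̲]` (`1 ≤ i ≤ r`), `K` any field; for
`K = ℚ` this is `Nesterenko.linForm` (`Nesterenko.linForm_eq`).
[cite: NesterenkoPhilippon2001, Ch. 3 §4 (p. 38)] -/
def linForm (r m : ℕ) (i : Fin r) : MvPolynomial ((Fin r × Fin (m + 1)) ⊕ Fin (m + 1)) K :=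
  ∑ j : Fin (m + 1), X (Sum.inl (i, j)) * X (Sum.inr j)

variable {K} {m : ℕ}

/-- The ideal `(I, L₁, …, L_r)` of `K[U, x̲]`, `K` any field; for `K = ℚ` this is
`Nesterenko.extIdeal` (`Nesterenko.extIdeal_eq`). [cite: NesterenkoPhilippon2001, Ch. 3 Def. 4.3 (p. 38)] -/
def extIdeal (I : Ideal (MvPolynomial (Fin (m + 1)) K)) (r : ℕ) :
    Ideal (MvPolynomial ((Fin r × Fin (m + 1)) ⊕ Fin (m + 1)) K) :=
  I.map (rename (Sum.inr : Fin (m + 1) → (Fin r × Fin (m + 1)) ⊕ Fin (m + 1))) ⊔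
    Ideal.span (Set.range (linForm K r m))

/-- **Definition 4.3** over an arbitrary field `K`: `Ī(r)` is the ideal of the `G ∈ K[U]` with
`G xⱼ^M ∈ (I, L₁, …, L_r)` for some `M > 0` and all `j`; for `K = ℚ` this is
`Nesterenko.elimIdeal` (`Nesterenko.elimIdeal_eq`). [cite: NesterenkoPhilippon2001, Ch. 3 Def. 4.3 (p. 38)] -/
def elimIdeal (I : Ideal (MvPolynomial (Fin (m + 1)) K)) (r : ℕ) :
    Ideal (MvPolynomial (Fin r × Fin (m + 1)) K) where
  carrier := {G | ∃ M : ℕ, 0 < M ∧ ∀ j : Fin (m + 1),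
    rename Sum.inl G * X (Sum.inr j) ^ M ∈ extIdeal I r}
  zero_mem' := ⟨1, one_pos, fun j => by simp⟩
  add_mem' := by
    rintro G₁ G₂ ⟨M₁, hM₁, h₁⟩ ⟨M₂, hM₂, h₂⟩
    refine ⟨M₁ + M₂, by omega, fun j => ?_⟩
    have e₁ : rename Sum.inl G₁ * X (Sum.inr j) ^ (M₁ + M₂) =
        (rename Sum.inl G₁ * X (Sum.inr j) ^ M₁) *
          (X (Sum.inr j) : MvPolynomial ((Fin r × Fin (m + 1)) ⊕ Fin (m + 1)) K) ^ M₂ := by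
      rw [pow_add]; ring
    have e₂ : rename Sum.inl G₂ * X (Sum.inr j) ^ (M₁ + M₂) =
        (rename Sum.inl G₂ * X (Sum.inr j) ^ M₂) *
          (X (Sum.inr j) : MvPolynomial ((Fin r × Fin (m + 1)) ⊕ Fin (m + 1)) K) ^ M₁ := by
      rw [pow_add]; ring
    rw [map_add, add_mul, e₁, e₂]
    exact Ideal.add_mem _ (Ideal.mul_mem_right _ _ (h₁ j)) (Ideal.mul_mem_right _ _ (h₂ j))
  smul_mem' := by
    rintro c G ⟨M, hM, h⟩
    refine ⟨M, hM, fun j => ?_⟩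
    rw [smul_eq_mul, map_mul, mul_assoc]
    exact Ideal.mul_mem_left _ _ (h j)

/-- Membership in `Ī(r)`, by definition. [cite: NesterenkoPhilippon2001, Ch. 3 Def. 4.3 (p. 38)] -/
theorem mem_elimIdeal_iff (I : Ideal (MvPolynomial (Fin (m + 1)) K)) (r : ℕ)
    (G : MvPolynomial (Fin r × Fin (m + 1)) K) :
    G ∈ elimIdeal I r ↔ ∃ M : ℕ, 0 < M ∧ ∀ j : Fin (m + 1),
      rename Sum.inl G * X (Sum.inr j) ^ M ∈ extIdeal I r :=
  Iff.rfl

/-- `Ī(r)` is monotone in `I`. [folklore] -/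
theorem elimIdeal_mono {I J : Ideal (MvPolynomial (Fin (m + 1)) K)} (h : I ≤ J) (r : ℕ) :
    elimIdeal I r ≤ elimIdeal J r := by
  rintro G ⟨M, hM, hG⟩
  have hle : extIdeal I r ≤ extIdeal J r := sup_le_sup_right (Ideal.map_mono h) _
  exact ⟨M, hM, fun j => hle (hG j)⟩

end NesterenkoK

/-! ### The case `K = ℚ`: agreement with `NesterenkoElimination.lean` -/

namespace Nesterenko

/-- `Nesterenko.linForm` is the case `K = ℚ` of `NesterenkoK.linForm`. [folklore] -/
theorem linForm_eq (r m : ℕ) : linForm r m = NesterenkoK.linForm ℚ r m := rfl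

/-- `Nesterenko.extIdeal` is the case `K = ℚ` of `NesterenkoK.extIdeal`. [folklore] -/
theorem extIdeal_eq {m : ℕ} (I : Ideal (Rx m)) (r : ℕ) : extIdeal I r = NesterenkoK.extIdeal I r :=
  rfl

/-- `Nesterenko.elimIdeal` is the case `K = ℚ` of `NesterenkoK.elimIdeal`. [folklore] -/
theorem elimIdeal_eq {m : ℕ} (I : Ideal (Rx m)) (r : ℕ) : elimIdeal I r = NesterenkoK.elimIdeal I r :=
  rfl

end Nesterenko

namespace NesterenkoK

variable {K : Type*} [Field K] {m : ℕ}

/-! ### The residue field `K(𝔭)` and the homomorphisms `Φⱼ : K[U, x̲] → K(𝔭)[U]` -/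

/-- The image `x̄ₖ` of the variable `xₖ` in the field `K(𝔭) = Frac(K[x̲]/𝔭)`. [folklore] -/
def xbar (𝔭 : Ideal (MvPolynomial (Fin (m + 1)) K)) [𝔭.IsPrime] (k : Fin (m + 1)) :
    FractionRing (MvPolynomial (Fin (m + 1)) K ⧸ 𝔭) :=
  algebraMap (MvPolynomial (Fin (m + 1)) K) _ (X k)

/-- The substitution defining `Φⱼ`: `xₖ ↦ x̄ₖ`, `u_{ik} ↦ u_{ik}` for `k ≠ j`, and
`u_{ij} ↦ −(∑_{k ≠ j} u_{ik} x̄ₖ) / x̄ⱼ` (so that `Lᵢ ↦ 0`). [folklore] -/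
def pivotFamily (𝔭 : Ideal (MvPolynomial (Fin (m + 1)) K)) [𝔭.IsPrime] (r : ℕ) (j : Fin (m + 1)) :
    (Fin r × Fin (m + 1)) ⊕ Fin (m + 1) →
      MvPolynomial (Fin r × Fin (m + 1)) (FractionRing (MvPolynomial (Fin (m + 1)) K ⧸ 𝔭)) :=
  Sum.elim
    (fun p => if p.2 = j then
        -(∑ k ∈ Finset.univ.erase j, X (p.1, k) * C (xbar 𝔭 k)) * C (xbar 𝔭 j)⁻¹
      else X p)
    (fun k => C (xbar 𝔭 k))

/-- The `K`-algebra homomorphism `Φⱼ : K[U, x̲] → K(𝔭)[U]` killing `𝔭` and the linear forms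
`Lᵢ` (pivot `j`, used when `xⱼ ∉ 𝔭`). [folklore] -/
def pivotMap (𝔭 : Ideal (MvPolynomial (Fin (m + 1)) K)) [𝔭.IsPrime] (r : ℕ) (j : Fin (m + 1)) :
    MvPolynomial ((Fin r × Fin (m + 1)) ⊕ Fin (m + 1)) K →ₐ[K]
      MvPolynomial (Fin r × Fin (m + 1)) (FractionRing (MvPolynomial (Fin (m + 1)) K ⧸ 𝔭)) :=
  aeval (pivotFamily 𝔭 r j)

variable (𝔭 : Ideal (MvPolynomial (Fin (m + 1)) K)) [𝔭.IsPrime] {r : ℕ}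

omit [𝔭.IsPrime] in
/-- `K[x̲] → K(𝔭)` has kernel `𝔭`. [folklore] -/
theorem algebraMap_eq_zero_iff (p : MvPolynomial (Fin (m + 1)) K) :
    algebraMap (MvPolynomial (Fin (m + 1)) K) (FractionRing (MvPolynomial (Fin (m + 1)) K ⧸ 𝔭)) p
      = 0 ↔ p ∈ 𝔭 := by
  rw [IsScalarTower.algebraMap_apply (MvPolynomial (Fin (m + 1)) K)
    (MvPolynomial (Fin (m + 1)) K ⧸ 𝔭) (FractionRing (MvPolynomial (Fin (m + 1)) K ⧸ 𝔭)),
    IsFractionRing.to_map_eq_zero_iff, Ideal.Quotient.algebraMap_eq, Ideal.Quotient.eq_zero_iff_mem]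

/-- `x̄ⱼ ≠ 0` for `xⱼ ∉ 𝔭`. [folklore] -/
theorem xbar_ne_zero {j : Fin (m + 1)} (hj : (X j : MvPolynomial (Fin (m + 1)) K) ∉ 𝔭) :
    xbar 𝔭 j ≠ 0 := by
  rw [xbar, Ne, algebraMap_eq_zero_iff]
  exact hj

/-- `Φⱼ(xₖ) = x̄ₖ`. [folklore] -/
@[simp] theorem pivotMap_X_inr (j k : Fin (m + 1)) :
    pivotMap 𝔭 r j (X (Sum.inr k)) = C (xbar 𝔭 k) := by
  simp [pivotMap, pivotFamily]

/-- `Φⱼ(u_{ik}) = u_{ik}` for `k ≠ j`. [folklore] -/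
theorem pivotMap_X_inl_of_ne (j : Fin (m + 1)) {i : Fin r} {k : Fin (m + 1)} (hk : k ≠ j) :
    pivotMap 𝔭 r j (X (Sum.inl (i, k))) = X (i, k) := by
  simp [pivotMap, pivotFamily, hk]

/-- `Φⱼ(u_{ij}) = −(∑_{k ≠ j} u_{ik} x̄ₖ) x̄ⱼ⁻¹`. [folklore] -/
theorem pivotMap_X_inl_self (j : Fin (m + 1)) (i : Fin r) :
    pivotMap 𝔭 r j (X (Sum.inl (i, j))) =
      -(∑ k ∈ Finset.univ.erase j, X (i, k) * C (xbar 𝔭 k)) * C (xbar 𝔭 j)⁻¹ := by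
  simp [pivotMap, pivotFamily]

/-- `Φⱼ` on `K[x̲]`: reduction modulo `𝔭` followed by the inclusion of constants. [folklore] -/
theorem pivotMap_rename_inr (j : Fin (m + 1)) (p : MvPolynomial (Fin (m + 1)) K) :
    pivotMap 𝔭 r j (rename Sum.inr p) =
      C (algebraMap (MvPolynomial (Fin (m + 1)) K) _ p) := by
  have hcomp : (pivotMap 𝔭 r j).comp (rename Sum.inr) =
      (IsScalarTower.toAlgHom K (FractionRing (MvPolynomial (Fin (m + 1)) K ⧸ 𝔭)) _).comp
        ((IsScalarTower.toAlgHom K (MvPolynomial (Fin (m + 1)) K)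
          (FractionRing (MvPolynomial (Fin (m + 1)) K ⧸ 𝔭)))) := by
    refine MvPolynomial.algHom_ext fun k => ?_
    simp [xbar]
  have := congrArg (fun f => f p) hcomp
  simpa using this

/-- `Φⱼ(Lᵢ) = 0` when `xⱼ ∉ 𝔭`. [folklore] -/
theorem pivotMap_linForm {j : Fin (m + 1)} (hj : (X j : MvPolynomial (Fin (m + 1)) K) ∉ 𝔭)
    (i : Fin r) : pivotMap 𝔭 r j (linForm K r m i) = 0 := by
  have hx := xbar_ne_zero 𝔭 hj
  rw [linForm, ← Finset.add_sum_erase _ _ (Finset.mem_univ j), map_add, map_sum, map_mul,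
    pivotMap_X_inl_self, pivotMap_X_inr]
  have hrest : ∑ k ∈ Finset.univ.erase j, pivotMap 𝔭 r j (X (Sum.inl (i, k)) * X (Sum.inr k)) =
      ∑ k ∈ Finset.univ.erase j, X (i, k) * C (xbar 𝔭 k) := by
    refine Finset.sum_congr rfl fun k hk => ?_
    rw [map_mul, pivotMap_X_inl_of_ne 𝔭 j (Finset.ne_of_mem_erase hk), pivotMap_X_inr]
  rw [hrest, mul_assoc, ← map_mul, inv_mul_cancel₀ hx, map_one, mul_one, neg_add_cancel]

/-- `(𝔭, L₁, …, L_r) ⊆ ker Φⱼ` when `xⱼ ∉ 𝔭`. [folklore] -/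
theorem extIdeal_le_ker_pivotMap {j : Fin (m + 1)}
    (hj : (X j : MvPolynomial (Fin (m + 1)) K) ∉ 𝔭) :
    extIdeal 𝔭 r ≤ RingHom.ker (pivotMap 𝔭 r j) := by
  refine sup_le ?_ ?_
  · rw [Ideal.map_le_iff_le_comap]
    intro p hp
    rw [Ideal.mem_comap, RingHom.mem_ker]
    change pivotMap 𝔭 r j (rename Sum.inr p) = 0
    rw [pivotMap_rename_inr, (algebraMap_eq_zero_iff 𝔭 p).2 hp, map_zero]
  · rw [Ideal.span_le]
    rintro _ ⟨i, rfl⟩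
    exact pivotMap_linForm 𝔭 hj i

/-! ### Saturation by `xⱼ`: eliminating the variables `u_{1j}, …, u_{rj}` modulo `(L₁, …, L_r)` -/

/-- `Lᵢ = u_{ij} xⱼ + ∑_{k ≠ j} u_{ik} xₖ`. [folklore] -/
theorem linForm_eq_add_sum (r : ℕ) (i : Fin r) (j : Fin (m + 1)) :
    linForm K r m i = X (Sum.inl (i, j)) * X (Sum.inr j) +
      ∑ k ∈ Finset.univ.erase j, X (Sum.inl (i, k)) * X (Sum.inr k) := by
  rw [linForm, ← Finset.add_sum_erase _ _ (Finset.mem_univ j)]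

omit [𝔭.IsPrime] in
/-- **Saturation by `xⱼ` modulo the linear forms.** For every `G ∈ K[U, x̲]` there are `N` and a
polynomial `H` not involving the variables `u_{1j}, …, u_{rj}` with
`xⱼ^N G ≡ H (mod (L₁, …, L_r))` (substitute `xⱼ u_{ij} = Lᵢ − ∑_{k≠j} u_{ik} xₖ`). [folklore] -/
theorem exists_pow_mul_sub_mem_span_linForm (r : ℕ) (j : Fin (m + 1))
    (G : MvPolynomial ((Fin r × Fin (m + 1)) ⊕ Fin (m + 1)) K) :
    ∃ (N : ℕ) (H : MvPolynomial ((Fin r × Fin (m + 1)) ⊕ Fin (m + 1)) K),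
      H ∈ supported K {v : (Fin r × Fin (m + 1)) ⊕ Fin (m + 1) | ∀ i : Fin r, v ≠ Sum.inl (i, j)} ∧
      X (Sum.inr j) ^ N * G - H ∈ Ideal.span (Set.range (linForm K r m)) := by
  classical
  set S := supported K {v : (Fin r × Fin (m + 1)) ⊕ Fin (m + 1) | ∀ i : Fin r, v ≠ Sum.inl (i, j)}
    with hS
  set 𝔏 : Ideal (MvPolynomial ((Fin r × Fin (m + 1)) ⊕ Fin (m + 1)) K) :=
    Ideal.span (Set.range (linForm K r m)) with h𝔏
  have hXmem : ∀ v : (Fin r × Fin (m + 1)) ⊕ Fin (m + 1), (∀ i : Fin r, v ≠ Sum.inl (i, j)) →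
      (X v : MvPolynomial _ K) ∈ S := by
    intro v hv
    rw [hS, mem_supported]
    intro w hw
    rw [Finset.mem_coe, vars_X] at hw
    rw [Finset.mem_singleton.1 hw]
    exact hv
  induction G using MvPolynomial.induction_on with
  | C a =>
    refine ⟨0, C a, ?_, by simp⟩
    exact Subalgebra.algebraMap_mem S a
  | add p q hp hq =>
    obtain ⟨N₁, H₁, hH₁, h₁⟩ := hp
    obtain ⟨N₂, H₂, hH₂, h₂⟩ := hq
    refine ⟨N₁ + N₂, X (Sum.inr j) ^ N₂ * H₁ + X (Sum.inr j) ^ N₁ * H₂, ?_, ?_⟩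
    · exact add_mem (mul_mem (pow_mem (hXmem _ fun i => by simp) _) hH₁)
        (mul_mem (pow_mem (hXmem _ fun i => by simp) _) hH₂)
    · have e : X (Sum.inr j) ^ (N₁ + N₂) * (p + q) -
          (X (Sum.inr j) ^ N₂ * H₁ + X (Sum.inr j) ^ N₁ * H₂) =
          X (Sum.inr j) ^ N₂ * (X (Sum.inr j) ^ N₁ * p - H₁) +
            X (Sum.inr j) ^ N₁ * (X (Sum.inr j) ^ N₂ * q - H₂) := by ring
      rw [e]
      exact Ideal.add_mem _ (Ideal.mul_mem_left _ _ h₁) (Ideal.mul_mem_left _ _ h₂)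
  | mul_X p v hp =>
    obtain ⟨N, H, hH, h⟩ := hp
    by_cases hv : ∀ i : Fin r, v ≠ Sum.inl (i, j)
    · refine ⟨N, H * X v, mul_mem hH (hXmem v hv), ?_⟩
      have e : X (Sum.inr j) ^ N * (p * X v) - H * X v =
          (X (Sum.inr j) ^ N * p - H) * X v := by ring
      rw [e]
      exact Ideal.mul_mem_right _ _ h
    · push Not at hv
      obtain ⟨i, rfl⟩ := hv
      -- `xⱼ u_{ij} = Lᵢ − Sᵢ`
      set Si : MvPolynomial ((Fin r × Fin (m + 1)) ⊕ Fin (m + 1)) K :=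
        ∑ k ∈ Finset.univ.erase j, X (Sum.inl (i, k)) * X (Sum.inr k) with hSi
      have hSiS : Si ∈ S := by
        refine Subalgebra.sum_mem _ fun k hk => mul_mem (hXmem _ fun i' => ?_) (hXmem _ fun i' => by simp)
        simp only [Ne, Sum.inl.injEq, Prod.mk.injEq, not_and]
        intro _
        exact Finset.ne_of_mem_erase hk
      refine ⟨N + 1, -(H * Si), neg_mem (mul_mem hH hSiS), ?_⟩
      have hL : linForm K r m i ∈ 𝔏 := Ideal.subset_span ⟨i, rfl⟩
      have e : X (Sum.inr j) ^ (N + 1) * (p * X (Sum.inl (i, j))) - -(H * Si) =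
          X (Sum.inr j) ^ N * p * linForm K r m i - (X (Sum.inr j) ^ N * p - H) * Si := by
        rw [linForm_eq_add_sum r i j]
        ring
      rw [e]
      exact Ideal.sub_mem _ (Ideal.mul_mem_left _ _ hL) (Ideal.mul_mem_right _ _ h)

/-! ### The kernel of `Φⱼ` on polynomials free of `u_{1j}, …, u_{rj}` -/

/-- On `K[x̲][u_{ik} : k ≠ j]` the map `Φⱼ` is reduction of the coefficients modulo `𝔭`: a
polynomial free of the variables `u_{ij}` killed by `Φⱼ` lies in `𝔭 K[U, x̲]`. [folklore] -/
theorem mem_map_of_pivotMap_eq_zero (j : Fin (m + 1))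
    {H : MvPolynomial ((Fin r × Fin (m + 1)) ⊕ Fin (m + 1)) K}
    (hH : H ∈ supported K {v : (Fin r × Fin (m + 1)) ⊕ Fin (m + 1) | ∀ i : Fin r, v ≠ Sum.inl (i, j)})
    (h0 : pivotMap 𝔭 r j H = 0) :
    H ∈ (𝔭.map (rename (Sum.inr : Fin (m + 1) → (Fin r × Fin (m + 1)) ⊕ Fin (m + 1))) :
      Ideal (MvPolynomial ((Fin r × Fin (m + 1)) ⊕ Fin (m + 1)) K)) := by
  classical
  set A := MvPolynomial (Fin (m + 1)) K with hA
  set L := FractionRing (MvPolynomial (Fin (m + 1)) K ⧸ 𝔭) with hL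
  set φ : A →+* L := algebraMap A L with hφ
  -- the pivot-free substitution `Φ₀`
  set Φ₀ : MvPolynomial ((Fin r × Fin (m + 1)) ⊕ Fin (m + 1)) K →ₐ[K]
      MvPolynomial (Fin r × Fin (m + 1)) L :=
    aeval (Sum.elim X (fun k => C (xbar 𝔭 k))) with hΦ₀
  -- `Φ₀ H = Φⱼ H` since `H` does not involve the `u_{ij}`
  have hagree : Φ₀ H = pivotMap 𝔭 r j H := by
    refine hom_congr_vars (f₁ := Φ₀.toRingHom) (f₂ := (pivotMap 𝔭 r j).toRingHom) ?_ ?_ rfl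
    · rw [← algebraMap_eq, AlgHom.toRingHom_eq_coe, AlgHom.toRingHom_eq_coe,
        AlgHom.comp_algebraMap, AlgHom.comp_algebraMap]
    · intro v hv _
      have hv' := (mem_supported.1 hH) hv
      simp only [Set.mem_setOf_eq] at hv'
      rcases v with ⟨i, k⟩ | k
      · have hk : k ≠ j := by
          intro hkj; subst hkj; exact hv' i rfl
        change Φ₀ (X (Sum.inl (i, k))) = pivotMap 𝔭 r j (X (Sum.inl (i, k)))
        rw [pivotMap_X_inl_of_ne 𝔭 j hk]
        simp [Φ₀]
      · change Φ₀ (X (Sum.inr k)) = pivotMap 𝔭 r j (X (Sum.inr k))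
        simp [Φ₀]
  -- `Φ₀ = map φ ∘ sumRingEquiv`
  set e := sumRingEquiv K (Fin r × Fin (m + 1)) (Fin (m + 1)) with he
  have hΦ₀eq : Φ₀.toRingHom = (MvPolynomial.map φ).comp e.toRingHom := by
    refine MvPolynomial.ringHom_ext (fun a => ?_) (fun v => ?_)
    · simp only [AlgHom.toRingHom_eq_coe, RingHom.coe_coe, RingHom.coe_comp,
        RingEquiv.toRingHom_eq_coe, Function.comp_apply, he, sumRingEquiv_C, map_C]
      rw [← algebraMap_eq, AlgHom.commutes, MvPolynomial.algebraMap_apply, hφ]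
      change C (algebraMap K L a) = C (algebraMap A L (algebraMap K A a))
      rw [← IsScalarTower.algebraMap_apply]
    · rcases v with u | k
      · simp [Φ₀, he, sumRingEquiv_X_inl]
      · simp [Φ₀, he, sumRingEquiv_X_inr, xbar, hφ]
        rfl
  -- hence all coefficients of `e H ∈ K[x̲][U]` lie in `𝔭`
  have hcoeff : e H ∈ (Ideal.map (C : A →+* MvPolynomial (Fin r × Fin (m + 1)) A) 𝔭 :
      Ideal (MvPolynomial (Fin r × Fin (m + 1)) A)) := by
    have hmap : MvPolynomial.map φ (e H) = 0 := by
      have h1 := congrArg (fun f => f H) hΦ₀eq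
      simp only [AlgHom.toRingHom_eq_coe, RingHom.coe_coe, RingHom.coe_comp,
        Function.comp_apply, RingEquiv.toRingHom_eq_coe] at h1
      rw [← h1, hagree, h0]
    rw [mem_map_C_iff]
    intro n
    rw [← algebraMap_eq_zero_iff 𝔭, ← hφ, ← coeff_map, hmap, coeff_zero]
  -- and pull back along `e.symm`, which maps `C p ↦ rename inr p`
  have hsymm : e.symm.toRingHom.comp (C : A →+* MvPolynomial (Fin r × Fin (m + 1)) A) =
      (rename (Sum.inr : Fin (m + 1) → (Fin r × Fin (m + 1)) ⊕ Fin (m + 1)) :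
        A →ₐ[K] _).toRingHom := by
    refine MvPolynomial.ringHom_ext (fun a => ?_) (fun k => ?_)
    · change e.symm (C (C a)) = rename Sum.inr (C a)
      rw [he, sumRingEquiv_symm_C_C, rename_C]
    · change e.symm (C (X k)) = rename Sum.inr (X k)
      rw [he, sumRingEquiv_symm_C_X, rename_X]
  have hH' : H = e.symm.toRingHom (e H) := by simp
  rw [hH']
  have hmem : e.symm.toRingHom (e H) ∈
      (Ideal.map (C : A →+* MvPolynomial (Fin r × Fin (m + 1)) A) 𝔭).map e.symm.toRingHom :=
    Ideal.mem_map_of_mem _ hcoeff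
  rw [Ideal.map_map, hsymm] at hmem
  exact hmem

/-! ### `Ī(r)` as the kernel of `Φⱼ` -/

/-- If `Φⱼ(G) = 0` (`xⱼ ∉ 𝔭`) then `xⱼ^N G ∈ (𝔭, L₁, …, L_r)` for some `N`. [folklore] -/
theorem exists_pow_mul_mem_extIdeal {j : Fin (m + 1)}
    (hj : (X j : MvPolynomial (Fin (m + 1)) K) ∉ 𝔭)
    {G : MvPolynomial ((Fin r × Fin (m + 1)) ⊕ Fin (m + 1)) K} (hG : pivotMap 𝔭 r j G = 0) :
    ∃ N : ℕ, X (Sum.inr j) ^ N * G ∈ extIdeal 𝔭 r := by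
  obtain ⟨N, H, hH, hNH⟩ := exists_pow_mul_sub_mem_span_linForm (K := K) r j G
  have hspan : Ideal.span (Set.range (linForm K r m)) ≤ extIdeal 𝔭 r := le_sup_right
  have h1 : X (Sum.inr j) ^ N * G - H ∈ extIdeal 𝔭 r := hspan hNH
  have hH0 : pivotMap 𝔭 r j H = 0 := by
    have := extIdeal_le_ker_pivotMap 𝔭 (r := r) hj h1
    rw [RingHom.mem_ker] at this
    change pivotMap 𝔭 r j (X (Sum.inr j) ^ N * G - H) = 0 at this
    rwa [map_sub, map_mul, hG, mul_zero, zero_sub, neg_eq_zero] at this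
  have hmaple : (𝔭.map (rename (Sum.inr : Fin (m + 1) → (Fin r × Fin (m + 1)) ⊕ Fin (m + 1))) :
      Ideal (MvPolynomial ((Fin r × Fin (m + 1)) ⊕ Fin (m + 1)) K)) ≤ extIdeal 𝔭 r := le_sup_left
  have hHmem : H ∈ extIdeal 𝔭 r := hmaple (mem_map_of_pivotMap_eq_zero 𝔭 j hH hH0)
  refine ⟨N, ?_⟩
  have e : X (Sum.inr j) ^ N * G = (X (Sum.inr j) ^ N * G - H) + H := by ring
  rw [e]
  exact Ideal.add_mem _ h1 hHmem

/-- Conversely, if `xₖ^N G ∈ (𝔭, L₁, …, L_r)` with `xₖ ∉ 𝔭` then `Φⱼ(G) = 0` (for any pivot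
`xⱼ ∉ 𝔭`). [folklore] -/
theorem pivotMap_eq_zero_of_pow_mul_mem {j k : Fin (m + 1)}
    (hj : (X j : MvPolynomial (Fin (m + 1)) K) ∉ 𝔭) (hk : (X k : MvPolynomial (Fin (m + 1)) K) ∉ 𝔭)
    {G : MvPolynomial ((Fin r × Fin (m + 1)) ⊕ Fin (m + 1)) K} {N : ℕ}
    (h : X (Sum.inr k) ^ N * G ∈ extIdeal 𝔭 r) : pivotMap 𝔭 r j G = 0 := by
  have := extIdeal_le_ker_pivotMap 𝔭 (r := r) hj h
  rw [RingHom.mem_ker] at this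
  change pivotMap 𝔭 r j (X (Sum.inr k) ^ N * G) = 0 at this
  rw [map_mul, map_pow, pivotMap_X_inr] at this
  exact (mul_eq_zero.1 this).resolve_left (pow_ne_zero _ ((map_ne_zero_iff _ (C_injective _ _)).2
    (xbar_ne_zero 𝔭 hk)))

/-- The kernel of `Φⱼ` does not depend on the pivot `xⱼ ∉ 𝔭`. [folklore] -/
theorem pivotMap_eq_zero_iff_pivotMap_eq_zero {j j' : Fin (m + 1)}
    (hj : (X j : MvPolynomial (Fin (m + 1)) K) ∉ 𝔭) (hj' : (X j' : MvPolynomial (Fin (m + 1)) K) ∉ 𝔭)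
    (G : MvPolynomial ((Fin r × Fin (m + 1)) ⊕ Fin (m + 1)) K) :
    pivotMap 𝔭 r j G = 0 ↔ pivotMap 𝔭 r j' G = 0 := by
  constructor
  · intro h
    obtain ⟨N, hN⟩ := exists_pow_mul_mem_extIdeal 𝔭 hj h
    exact pivotMap_eq_zero_of_pow_mul_mem 𝔭 hj' hj hN
  · intro h
    obtain ⟨N, hN⟩ := exists_pow_mul_mem_extIdeal 𝔭 hj' h
    exact pivotMap_eq_zero_of_pow_mul_mem 𝔭 hj hj' hN

/-- **`Ī(r) = ker (Φⱼ|K[U])`** for a prime ideal `𝔭` and any variable `xⱼ ∉ 𝔭`: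
`G ∈ Ī(r) ⟺ Φⱼ(G) = 0`. [folklore] -/
theorem mem_elimIdeal_iff_pivotMap_eq_zero {j : Fin (m + 1)}
    (hj : (X j : MvPolynomial (Fin (m + 1)) K) ∉ 𝔭) (G : MvPolynomial (Fin r × Fin (m + 1)) K) :
    G ∈ elimIdeal 𝔭 r ↔ pivotMap 𝔭 r j (rename Sum.inl G) = 0 := by
  constructor
  · rintro ⟨M, -, hM⟩
    have h := hM j
    rw [mul_comm] at h
    exact pivotMap_eq_zero_of_pow_mul_mem 𝔭 hj hj h
  · intro h
    -- for every `k` some power of `xₖ` multiplies `G` into `(𝔭, L)`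
    have hk : ∀ k : Fin (m + 1), ∃ N : ℕ, X (Sum.inr k) ^ N * rename Sum.inl G ∈ extIdeal 𝔭 r := by
      intro k
      by_cases hXk : (X k : MvPolynomial (Fin (m + 1)) K) ∈ 𝔭
      · refine ⟨1, ?_⟩
        rw [pow_one]
        have hmaple : (𝔭.map (rename (Sum.inr : Fin (m + 1) → (Fin r × Fin (m + 1)) ⊕ Fin (m + 1))) :
            Ideal (MvPolynomial ((Fin r × Fin (m + 1)) ⊕ Fin (m + 1)) K)) ≤ extIdeal 𝔭 r :=
          le_sup_left
        refine Ideal.mul_mem_right _ _ (hmaple ?_)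
        have : (X (Sum.inr k) : MvPolynomial ((Fin r × Fin (m + 1)) ⊕ Fin (m + 1)) K) =
            rename Sum.inr (X k) := by rw [rename_X]
        rw [this]
        exact Ideal.mem_map_of_mem _ hXk
      · exact exists_pow_mul_mem_extIdeal 𝔭 hXk
          ((pivotMap_eq_zero_iff_pivotMap_eq_zero 𝔭 hj hXk _).1 h)
    choose N hN using hk
    refine ⟨1 + ∑ k, N k, by omega, fun k => ?_⟩
    have hle : N k ≤ 1 + ∑ k, N k :=
      le_add_left (Finset.single_le_sum (fun _ _ => Nat.zero_le _) (Finset.mem_univ k))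
    obtain ⟨d, hd⟩ := Nat.exists_eq_add_of_le hle
    rw [hd, pow_add, mul_comm, mul_assoc, mul_comm _ (rename Sum.inl G), ← mul_assoc]
    exact Ideal.mul_mem_right _ _ (hN k)

/-- `Ī(r)` is the contraction of `ker Φⱼ` to `K[U]`. [folklore] -/
theorem elimIdeal_eq_comap_ker {j : Fin (m + 1)} (hj : (X j : MvPolynomial (Fin (m + 1)) K) ∉ 𝔭)
    (r : ℕ) :
    elimIdeal 𝔭 r = (RingHom.ker (pivotMap 𝔭 r j)).comap
      (rename (Sum.inl : Fin r × Fin (m + 1) → (Fin r × Fin (m + 1)) ⊕ Fin (m + 1)) :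
        MvPolynomial (Fin r × Fin (m + 1)) K →ₐ[K] _) := by
  ext G
  rw [mem_elimIdeal_iff_pivotMap_eq_zero 𝔭 hj, Ideal.mem_comap, RingHom.mem_ker]

/-- **The elimination ideal of a prime ideal is prime** (given a variable `xⱼ ∉ 𝔭`; cf.
[NesterenkoPhilippon2001, Ch. 3 Prop. 4.4]: `Ī(r) = (F)` with `F` irreducible).
[cite: NesterenkoPhilippon2001, Ch. 3 Prop. 4.4 (p. 38)] -/
theorem isPrime_elimIdeal {j : Fin (m + 1)} (hj : (X j : MvPolynomial (Fin (m + 1)) K) ∉ 𝔭)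
    (r : ℕ) : (elimIdeal 𝔭 r).IsPrime := by
  rw [elimIdeal_eq_comap_ker 𝔭 hj r]
  haveI : (RingHom.ker (pivotMap 𝔭 r j)).IsPrime := RingHom.ker_isPrime _
  exact Ideal.comap_isPrime _ _

end NesterenkoK

/-! ### Consequences for `K = ℚ` -/

namespace Nesterenko

variable {m : ℕ}

/-- For a prime ideal `𝔭 ⊂ ℚ[x₀, …, x_m]` not containing the variable `xⱼ`, the elimination
ideal `Ī(r)` of Definition 4.3 is a prime ideal of `ℚ[U]`.
[cite: NesterenkoPhilippon2001, Ch. 3 Prop. 4.4 (p. 38)] -/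
theorem isPrime_elimIdeal_of_X_notMem (𝔭 : Ideal (Rx m)) [𝔭.IsPrime] {j : Fin (m + 1)}
    (hj : (X j : Rx m) ∉ 𝔭) (r : ℕ) : (elimIdeal 𝔭 r).IsPrime := by
  rw [elimIdeal_eq]
  exact NesterenkoK.isPrime_elimIdeal 𝔭 hj r

end Nesterenko

end Literature.NumberTheory.Transcendental
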